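import Mathlib
import Summits.MatrixMultiplication.MatrixMultiplication.Theorems.SubgroupIdentityDesigns.Negative.LevelOneDimSqueeze
import Summits.MatrixMultiplication.MatrixMultiplication.Theorems.GradedDesignFamily.Negative.ExponentTwoEndpoint
import Summits.MatrixMultiplication.MatrixMultiplication.Theorems.LevelGradedCohnUmansGradedDesignFamilyStubBlockContainment

/-!
# Classification of the level-one irreducible characters of `GL_m(𝔽_p)` and the exact dimension
# of the level-one space (support lemma for the crux `SubgroupIdentityDesigns`,
# stmt-MatrixMultiplication-14079; cell B2b-5 `b2b-lgcu-borel`, gen 11 — report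
# `run/shared/lean/b2b/levelgraded-cu/ORACLE-g11.md` §G11-5)

`G = GL_{1+l}(𝔽_p)`, `l ≥ 1`, `F_1|_G = levelSubmodule p (1+l) 1` (span of the restricted waves
`ψ(tr(M g))`, `rk M ≤ 1`), `a = (p^{1+l} − p)/(p − 1)`, `b = (p^{1+l} − 1)/(p − 1) = [1+l]_p`.

* `budget_two_eq_finrank` — for every `(p, m, k)`: `budget p m k 2 = dim F_k|_G` (the two landed
  halves of Wedderburn for the bi-invariant `F_k|_G`: `finrank_le_gradedBudget_two` and
  `stub_blockContainment`).  So the exponent-2 budget IS the dimension, at every level.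
* `finrank_levelOne_eq`, `budget_two_levelOne_eq` — **`dim F_1|_G = 1 + a² + (p−2) b²` EXACTLY**
  (the upper bound `LevelOneDim.finrank_levelOne_le_real` meets the floor
  `LevelOneExact.budget_ge_exact` at `s = 2`).
* `irr_levelOne_cases`, `ncard_irr_levelOne`, `degree_irr_levelOne` — **CLASSIFICATION**: an
  irreducible character of `GL_{1+l}(𝔽_p)` has level `≤ 1` iff it is the trivial character, the
  Steinberg-type constituent `Θ − 1` of the permutation character on `ℙ^l(𝔽_p)`, or one of the
  `p − 2` principal-series characters `Ψ_χ = Ind_{P_1}^G (χ ∘ (top-left entry))`, `χ ≠ 1`; there are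
  EXACTLY `p` of them, of degrees `1, a, b`.  (Elementary proof: the `p` listed characters lie in
  `F_1` and already exhaust its dimension; any further irreducible constituent would add `≥ 1`.)
  This is the rank-one case of the Gurevich–Howe "tensor rank" filtration, obtained here without
  the η-correspondence.
* `no_levelOne_witness_count` — the small-`ε` level-one no-go RE-DERIVED from the landed packing law
  `PackingBridge.crux_law` (`2^{(2+ε)/3} < #(Irr ∩ F_k)^ε` for any witness) and the count `p`:
  no level-one witness once `p^ε ≤ 2^{(2+ε)/3}` — the same threshold `ε ≤ 2 log 2/(3 log p − log 2)`
  as `LevelOneDimSqueeze.no_levelOne_witness_small_eps`.  MORAL for higher level: the small-`ε`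
  question at level `k` is EXACTLY the count `#(Irr(GL_m(𝔽_p)) ∩ F_k)` (conjecturally
  `Σ_{j ≤ k} #Irr(GL_j(𝔽_p)) < 2 p^k`, uniformly in `m ≥ 2k`).

Sorry-free; standard axioms.  VALUE = theorem (exactness / classification), NOT summit progress.
-/

set_option linter.dupNamespace false

open scoped BigOperators Classical Matrix
open Module (finrank)

namespace Summit.MatrixMultiplication.MatrixMultiplication.Theorems.SubgroupIdentityDesigns.Negative
namespace LevelOneClassification

open Literature.RepresentationTheory.FiniteGroups
open Literature.Barriers.MatrixMultiplication (SubgroupTPP)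
open Summit.MatrixMultiplication.MatrixMultiplication.Theorems.LieRankDesigns.Negative
open Summit.MatrixMultiplication.MatrixMultiplication.Theorems.LevelOneGL2Designs.Negative
  (levelSubmodule levelSubmodule_bi_inv)
open Summit.MatrixMultiplication.MatrixMultiplication.Theorems.GradedDesignFamily
  (stub_blockContainment)
open Summit.MatrixMultiplication.MatrixMultiplication.Theorems.GradedDesignFamily.Negative
  (finrank_le_gradedBudget_two one_le_re_apply_one)
open LineStabilizer (lineStab)
open LineStabilizerCharacter (theta_sub_triv_one)
open PrincipalSeriesOne (psChar psChar_one)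
open PrincipalSeriesIrreducible (psChar_ne)
open PrincipalSeriesBudget (psChar_mem steinberg_mem card_mulChar)
open BlockSliceDesignOne (i0)
open PackingBridge (coe_levelSubmodule budget_eq crux_law)
open LevelOneExact (budget_ge_exact card_quotient_real)
open LevelOneDim (finrank_levelOne_le_real)

variable {p : ℕ} [hp : Fact p.Prime]

/-! ## The exponent-2 budget is the dimension -/

/-- **`budget p m k 2 = dim F_k|_{GL_m(𝔽_p)}`** for every prime `p`, every `m`, every level `k`
(Wedderburn for the bi-invariant space `F_k|_G`: `Σ_{χ ∈ Irr ∩ F_k} χ(1)² = dim F_k|_G`). -/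
theorem budget_two_eq_finrank {m k : ℕ} :
    budget p m k 2 = (finrank ℂ (levelSubmodule p m k) : ℝ) := by
  rw [budget_eq]
  refine le_antisymm ?_ ?_
  · exact stub_blockContainment (GLm p m) (levelSubmodule p m k) levelSubmodule_bi_inv
  · exact finrank_le_gradedBudget_two (levelSubmodule p m k) levelSubmodule_bi_inv

variable {l : ℕ}

/-- **EXACT DIMENSION OF THE LEVEL-ONE SPACE**: `dim F_1|_{GL_{1+l}(𝔽_p)} = 1 + a² + (p−2) b²`
(`l ≥ 1`). -/
theorem finrank_levelOne_eq (hl : 1 ≤ l) :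
    (finrank ℂ (levelSubmodule p (1 + l) 1) : ℝ) =
      1 + (((p : ℝ) ^ (1 + l) - p) / ((p : ℝ) - 1)) ^ 2 +
        ((p : ℝ) - 2) * (((p : ℝ) ^ (1 + l) - 1) / ((p : ℝ) - 1)) ^ 2 := by
  refine le_antisymm (finrank_levelOne_le_real (p := p) (m := 1 + l) (by omega)) ?_
  have h := budget_ge_exact (p := p) hl 2
  rw [budget_two_eq_finrank] at h
  have hp2 : (2 : ℝ) ≤ p := by exact_mod_cast hp.out.two_le
  have hp1 : (0 : ℝ) < (p : ℝ) - 1 := by linarith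
  have hPp : (p : ℝ) ≤ (p : ℝ) ^ (1 + l) := by
    calc (p : ℝ) = (p : ℝ) ^ 1 := (pow_one _).symm
      _ ≤ (p : ℝ) ^ (1 + l) := pow_le_pow_right₀ (by linarith) (by omega)
  have ha0 : 0 ≤ ((p : ℝ) ^ (1 + l) - p) / ((p : ℝ) - 1) := div_nonneg (by linarith) hp1.le
  have hb0 : 0 ≤ ((p : ℝ) ^ (1 + l) - 1) / ((p : ℝ) - 1) := div_nonneg (by linarith) hp1.le
  rw [Real.rpow_two, Real.rpow_two] at h
  exact h

/-- `budget p (1+l) 1 2 = 1 + a² + (p−2) b²`: the exponent-2 level-one budget is exactly the floor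
of `LevelOneExact.budget_ge_exact`. -/
theorem budget_two_levelOne_eq (hl : 1 ≤ l) :
    budget p (1 + l) 1 2 =
      1 + (((p : ℝ) ^ (1 + l) - p) / ((p : ℝ) - 1)) ^ 2 +
        ((p : ℝ) - 2) * (((p : ℝ) ^ (1 + l) - 1) / ((p : ℝ) - 1)) ^ 2 := by
  rw [budget_two_eq_finrank, finrank_levelOne_eq hl]

/-! ## The classification -/

/-- The finite set `Irr(GL_{1+l}(𝔽_p)) ∩ F_1` EQUALS the explicit family
`{Θ − 1} ∪ {1} ∪ {Ψ_χ : χ ≠ 1}` (as finsets), `l ≥ 1`. -/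
theorem irr_levelOne_toFinset_eq (hl : 1 ≤ l)
    (hfin : (irrChars (GLm p (1 + l)) ∩ levelSet p (1 + l) 1).Finite) :
    letI : Fintype (MulChar (ZMod p) ℂ) := Fintype.ofFinite _
    hfin.toFinset =
      insert (((indClassFun (G := GLm p (1 + l)) (lineStab (F := ZMod p) (i0 : Fin (1 + l)))
          (fun _ => (1 : ℂ))) - (Representation.character (Representation.trivial ℂ
          (GLm p (1 + l)) ℂ)) : (GLm p (1 + l)) → ℂ))
        (insert ((Representation.trivial ℂ (GLm p (1 + l)) ℂ).character)
          ((Finset.univ.erase (1 : MulChar (ZMod p) ℂ)).image fun χ =>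
            ((psChar (F := ZMod p) (i0 : Fin (1 + l))) χ : (GLm p (1 + l)) → ℂ))) := by
  letI : Fintype (MulChar (ZMod p) ℂ) := Fintype.ofFinite _
  have hp2 : 2 ≤ p := hp.out.two_le
  have hpR : (2 : ℝ) ≤ p := by exact_mod_cast hp2
  have hp1R : (0 : ℝ) < (p : ℝ) - 1 := by linarith
  -- names for the three kinds of characters
  set triv : GLm p (1 + l) → ℂ := (Representation.trivial ℂ (GLm p (1 + l)) ℂ).character
    with htriv
  set St : GLm p (1 + l) → ℂ := ((indClassFun (G := GLm p (1 + l)) (lineStab (F := ZMod p)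
      (i0 : Fin (1 + l))) (fun _ => (1 : ℂ))) - (Representation.character (Representation.trivial ℂ
      (GLm p (1 + l)) ℂ)) : (GLm p (1 + l)) → ℂ) with hSt
  set ps : MulChar (ZMod p) ℂ → (GLm p (1 + l) → ℂ) := fun χ => ((psChar (F := ZMod p) (i0 : Fin
      (1 + l))) χ : (GLm p (1 + l)) → ℂ) with hps
  set T : Finset (MulChar (ZMod p) ℂ) := Finset.univ.erase (1 : MulChar (ZMod p) ℂ) with hT
  set Fam : Finset (GLm p (1 + l) → ℂ) := insert St (insert triv (T.image ps)) with hFam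
  -- exact degrees (real parts at `1`)
  have hQ := card_quotient_real (p := p) (l := l)
  have hdeg_triv : (triv 1).re = 1 := by rw [htriv, character_trivial_apply, Complex.one_re]
  have hdeg_St : (St 1).re = ((p : ℝ) ^ (1 + l) - p) / ((p : ℝ) - 1) := by
    rw [hSt, theta_sub_triv_one]
    simp only [Complex.sub_re, Complex.natCast_re, Complex.one_re]
    rw [hQ, eq_div_iff hp1R.ne', sub_mul, div_mul_cancel₀ _ hp1R.ne']
    ring
  have hdeg_ps : ∀ χ, (ps χ 1).re = ((p : ℝ) ^ (1 + l) - 1) / ((p : ℝ) - 1) := by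
    intro χ
    rw [hps]
    simp only [psChar_one, Complex.natCast_re]
    exact hQ
  -- the degrees separate the three kinds
  have hP2 : (p : ℝ) ^ 2 ≤ (p : ℝ) ^ (1 + l) := pow_le_pow_right₀ (by linarith) (by omega)
  have hSt_ne_triv : St ≠ triv := by
    intro h
    have := congr_arg (fun f : GLm p (1 + l) → ℂ => (f 1).re) h
    rw [hdeg_triv, hdeg_St, div_eq_iff hp1R.ne'] at this
    nlinarith [hP2, hpR]
  have htriv_notin : triv ∉ T.image ps := by
    intro h
    obtain ⟨χ, _, hχ⟩ := Finset.mem_image.mp h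
    have := congr_arg (fun f : GLm p (1 + l) → ℂ => (f 1).re) hχ
    rw [hdeg_ps, hdeg_triv, div_eq_iff hp1R.ne'] at this
    nlinarith [hP2, hpR]
  have hSt_notin : St ∉ insert triv (T.image ps) := by
    rw [Finset.mem_insert, not_or]
    refine ⟨hSt_ne_triv, fun h => ?_⟩
    obtain ⟨χ, _, hχ⟩ := Finset.mem_image.mp h
    have := congr_arg (fun f : GLm p (1 + l) → ℂ => (f 1).re) hχ
    rw [hdeg_ps, hdeg_St, div_eq_iff hp1R.ne', div_mul_cancel₀ _ hp1R.ne'] at this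
    linarith
  have hinj : Set.InjOn ps ↑T := by
    intro χ hχ χ' _ e
    by_contra hne
    exact psChar_ne (i0 : Fin (1 + l)) (Finset.ne_of_mem_erase (Finset.mem_coe.mp hχ)) hne e
  -- all of them lie in `Irr ∩ F_1`
  have hsub : Fam ⊆ hfin.toFinset := by
    intro ψ hψ
    rw [Set.Finite.mem_toFinset]
    rcases Finset.mem_insert.mp hψ with rfl | hψ
    · exact steinberg_mem hl
    rcases Finset.mem_insert.mp hψ with rfl | hψ
    · exact trivial_mem_levelSet (p := p) (m := 1 + l) 1
    · obtain ⟨χ, hχ, rfl⟩ := Finset.mem_image.mp hψ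
      exact psChar_mem (Finset.ne_of_mem_erase hχ)
  have hcount : T.card = p - 2 := by
    rw [hT, Finset.card_erase_of_mem (Finset.mem_univ _), Finset.card_univ, ← Nat.card_eq_fintype_card,
      card_mulChar]
    omega
  have hcountR : (T.card : ℝ) = (p : ℝ) - 2 := by
    rw [hcount, Nat.cast_sub hp2]; norm_num
  -- the family's exponent-2 sum is the whole dimension
  have hFam_sum : ∑ ψ ∈ Fam, (ψ 1).re ^ (2 : ℝ) =
      1 + (((p : ℝ) ^ (1 + l) - p) / ((p : ℝ) - 1)) ^ 2 +
        ((p : ℝ) - 2) * (((p : ℝ) ^ (1 + l) - 1) / ((p : ℝ) - 1)) ^ 2 := by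
    rw [hFam, Finset.sum_insert hSt_notin, Finset.sum_insert htriv_notin, Finset.sum_image hinj,
      Finset.sum_congr rfl fun χ _ => by rw [hdeg_ps χ], Finset.sum_const, nsmul_eq_mul, hcountR,
      hdeg_St, hdeg_triv, Real.one_rpow, Real.rpow_two, Real.rpow_two]
    ring
  have htot : ∑ ψ ∈ hfin.toFinset, (ψ 1).re ^ (2 : ℝ) = budget p (1 + l) 1 2 := by
    unfold budget
    rw [finsum_mem_eq_finite_toFinset_sum _ hfin]
  -- no room for a further irreducible constituent
  refine (Finset.Subset.antisymm ?_ hsub)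
  intro ψ hψ
  by_contra hψF
  have hmem : ψ ∈ hfin.toFinset \ Fam := Finset.mem_sdiff.mpr ⟨hψ, hψF⟩
  have hψirr : IsIrrChar (GLm p (1 + l)) ψ := ((Set.Finite.mem_toFinset hfin).mp hψ).1
  have h1 : (1 : ℝ) ≤ (ψ 1).re ^ (2 : ℝ) := by
    have := one_le_re_apply_one hψirr
    rw [Real.rpow_two]; nlinarith
  have hrest : (1 : ℝ) ≤ ∑ φ ∈ hfin.toFinset \ Fam, (φ 1).re ^ (2 : ℝ) := by
    calc (1 : ℝ) ≤ (ψ 1).re ^ (2 : ℝ) := h1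
      _ ≤ ∑ φ ∈ hfin.toFinset \ Fam, (φ 1).re ^ (2 : ℝ) :=
          Finset.single_le_sum (f := fun φ : GLm p (1 + l) → ℂ => (φ 1).re ^ (2 : ℝ))
            (fun φ hφ => Real.rpow_nonneg (re_apply_one_nonneg
              ((Set.Finite.mem_toFinset hfin).mp (Finset.mem_sdiff.mp hφ).1).1) _) hmem
  have hsplit := Finset.sum_sdiff hsub (f := fun φ : GLm p (1 + l) → ℂ => (φ 1).re ^ (2 : ℝ))
  have hB := budget_two_levelOne_eq (p := p) hl
  rw [← htot, ← hsplit, hFam_sum] at hB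
  linarith

/-- **CLASSIFICATION OF THE LEVEL-ONE IRREDUCIBLE CHARACTERS OF `GL_{1+l}(𝔽_p)`** (`l ≥ 1`): an
irreducible character `ψ` lies in `F_1` iff it is the Steinberg-type character `Θ − 1`, the
trivial character, or a principal-series character `Ψ_χ`, `χ ≠ 1`. -/
theorem irr_levelOne_cases (hl : 1 ≤ l) {ψ : GLm p (1 + l) → ℂ}
    (hψ : IsIrrChar (GLm p (1 + l)) ψ) (hψ1 : ψ ∈ levelSet p (1 + l) 1) :
    ψ = ((indClassFun (G := GLm p (1 + l)) (lineStab (F := ZMod p) (i0 : Fin (1 + l)))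
          (fun _ => (1 : ℂ))) - (Representation.character (Representation.trivial ℂ
          (GLm p (1 + l)) ℂ)) : (GLm p (1 + l)) → ℂ) ∨
      ψ = (Representation.trivial ℂ (GLm p (1 + l)) ℂ).character ∨
      ∃ χ : MulChar (ZMod p) ℂ, χ ≠ 1 ∧
        ψ = ((psChar (F := ZMod p) (i0 : Fin (1 + l))) χ : (GLm p (1 + l)) → ℂ) := by
  letI : Fintype (MulChar (ZMod p) ℂ) := Fintype.ofFinite _
  have hfin : (irrChars (GLm p (1 + l)) ∩ levelSet p (1 + l) 1).Finite :=
    (irrChars_finite_holds (GLm p (1 + l))).subset Set.inter_subset_left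
  have hmem : ψ ∈ hfin.toFinset := (Set.Finite.mem_toFinset hfin).mpr ⟨hψ, hψ1⟩
  rw [irr_levelOne_toFinset_eq hl hfin] at hmem
  rcases Finset.mem_insert.mp hmem with h | hmem
  · exact Or.inl h
  rcases Finset.mem_insert.mp hmem with h | hmem
  · exact Or.inr (Or.inl h)
  obtain ⟨χ, hχ, rfl⟩ := Finset.mem_image.mp hmem
  exact Or.inr (Or.inr ⟨χ, Finset.ne_of_mem_erase hχ, rfl⟩)

/-- **EXACTLY `p` irreducible characters of `GL_{1+l}(𝔽_p)` have level `≤ 1`** (`l ≥ 1`). -/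
theorem ncard_irr_levelOne (hl : 1 ≤ l) :
    (irrChars (GLm p (1 + l)) ∩ levelSet p (1 + l) 1).ncard = p := by
  letI : Fintype (MulChar (ZMod p) ℂ) := Fintype.ofFinite _
  have hp2 : 2 ≤ p := hp.out.two_le
  have hpR : (2 : ℝ) ≤ p := by exact_mod_cast hp2
  have hp1R : (0 : ℝ) < (p : ℝ) - 1 := by linarith
  have hfin : (irrChars (GLm p (1 + l)) ∩ levelSet p (1 + l) 1).Finite :=
    (irrChars_finite_holds (GLm p (1 + l))).subset Set.inter_subset_left
  rw [Set.ncard_eq_toFinset_card _ hfin, irr_levelOne_toFinset_eq hl hfin]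
  have hQ := card_quotient_real (p := p) (l := l)
  have hP2 : (p : ℝ) ^ 2 ≤ (p : ℝ) ^ (1 + l) := pow_le_pow_right₀ (by linarith) (by omega)
  have hdeg_ps : ∀ χ : MulChar (ZMod p) ℂ, (((psChar (F := ZMod p) (i0 : Fin (1 + l))) χ :
      (GLm p (1 + l)) → ℂ) 1).re = ((p : ℝ) ^ (1 + l) - 1) / ((p : ℝ) - 1) := by
    intro χ
    simp only [psChar_one, Complex.natCast_re]
    exact hQ
  have hdeg_St : (((indClassFun (G := GLm p (1 + l)) (lineStab (F := ZMod p) (i0 : Fin (1 + l)))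
      (fun _ => (1 : ℂ))) - (Representation.character (Representation.trivial ℂ
      (GLm p (1 + l)) ℂ)) : (GLm p (1 + l)) → ℂ) 1).re = ((p : ℝ) ^ (1 + l) - p) / ((p : ℝ) - 1) := by
    rw [theta_sub_triv_one]
    simp only [Complex.sub_re, Complex.natCast_re, Complex.one_re]
    rw [hQ, eq_div_iff hp1R.ne', sub_mul, div_mul_cancel₀ _ hp1R.ne']
    ring
  have hdeg_triv : (((Representation.trivial ℂ (GLm p (1 + l)) ℂ).character) 1).re = 1 := by
    rw [character_trivial_apply, Complex.one_re]
  rw [Finset.card_insert_of_notMem, Finset.card_insert_of_notMem, Finset.card_image_of_injOn,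
    Finset.card_erase_of_mem (Finset.mem_univ _), Finset.card_univ, ← Nat.card_eq_fintype_card,
    card_mulChar]
  · omega
  · intro χ hχ χ' _ e
    by_contra hne
    exact psChar_ne (i0 : Fin (1 + l)) (Finset.ne_of_mem_erase (Finset.mem_coe.mp hχ)) hne e
  · intro h
    obtain ⟨χ, _, hχ⟩ := Finset.mem_image.mp h
    have := congr_arg (fun f : GLm p (1 + l) → ℂ => (f 1).re) hχ
    rw [hdeg_ps, hdeg_triv, div_eq_iff hp1R.ne'] at this
    nlinarith [hP2, hpR]
  · rw [Finset.mem_insert, not_or]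
    refine ⟨fun h => ?_, fun h => ?_⟩
    · have := congr_arg (fun f : GLm p (1 + l) → ℂ => (f 1).re) h
      rw [hdeg_triv, hdeg_St, div_eq_iff hp1R.ne'] at this
      nlinarith [hP2, hpR]
    · obtain ⟨χ, _, hχ⟩ := Finset.mem_image.mp h
      have := congr_arg (fun f : GLm p (1 + l) → ℂ => (f 1).re) hχ
      rw [hdeg_ps, hdeg_St, div_eq_iff hp1R.ne', div_mul_cancel₀ _ hp1R.ne'] at this
      linarith

/-- The degree of a level-one irreducible character of `GL_{1+l}(𝔽_p)` (`l ≥ 1`) is `a`, `1` or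
`b`. -/
theorem degree_irr_levelOne (hl : 1 ≤ l) {ψ : GLm p (1 + l) → ℂ}
    (hψ : IsIrrChar (GLm p (1 + l)) ψ) (hψ1 : ψ ∈ levelSet p (1 + l) 1) :
    (ψ 1).re = ((p : ℝ) ^ (1 + l) - p) / ((p : ℝ) - 1) ∨ (ψ 1).re = 1 ∨
      (ψ 1).re = ((p : ℝ) ^ (1 + l) - 1) / ((p : ℝ) - 1) := by
  have hpR : (2 : ℝ) ≤ p := by exact_mod_cast hp.out.two_le
  have hp1R : (0 : ℝ) < (p : ℝ) - 1 := by linarith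
  have hQ := card_quotient_real (p := p) (l := l)
  rcases irr_levelOne_cases hl hψ hψ1 with rfl | rfl | ⟨χ, -, rfl⟩
  · left
    rw [theta_sub_triv_one]
    simp only [Complex.sub_re, Complex.natCast_re, Complex.one_re]
    rw [hQ, eq_div_iff hp1R.ne', sub_mul, div_mul_cancel₀ _ hp1R.ne']
    ring
  · right; left
    rw [character_trivial_apply, Complex.one_re]
  · right; right
    simp only [psChar_one, Complex.natCast_re]
    exact hQ

/-! ## The small-`ε` level-one no-go, re-derived from the packing law and the count -/

/-- **No level-one witness once `p^ε ≤ 2^{(2+ε)/3}`** — the packing law `crux_law`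
(`2^{(2+ε)/3} < #(Irr ∩ F_1)^ε` for any witness) against the count `#(Irr ∩ F_1) = p`.  Same
threshold `ε ≤ 2 log 2/(3 log p − log 2)` as `LevelOneDimSqueeze.no_levelOne_witness_small_eps`,
by a different route; the template for every level `k`: a bound `#(Irr(GL_m(𝔽_p)) ∩ F_k) ≤ N(p,k)`
uniform in `m` kills all level-`k` witnesses with `N(p,k)^ε ≤ 2^{(2+ε)/3}`. -/
theorem no_levelOne_witness_count (hl : 1 ≤ l) {ε : ℝ} (hε : 0 < ε)
    (hthr : (p : ℝ) ^ ε ≤ (2 : ℝ) ^ ((2 + ε) / 3))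
    {H₁ H₂ H₃ : Subgroup (GLm p (1 + l))} (htpp : SubgroupTPP H₁ H₂ H₃)
    (hdes : ∃ c : Mat p (1 + l) → ℂ, (∀ M, 1 < M.rank → c M = 0) ∧
      (∑ M, c M * ZMod.stdAddChar (Matrix.trace (M * ((1 : GLm p (1 + l)) : Mat p (1 + l))))) = 1 ∧
      ∀ a ∈ H₁, ∀ b ∈ H₂, ∀ g ∈ H₃, a * b * g ≠ 1 →
        (∑ M, c M * ZMod.stdAddChar
          (Matrix.trace (M * ((a * b * g : GLm p (1 + l)) : Mat p (1 + l))))) = 0) :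
    ¬ budget p (1 + l) 1 (2 + ε) <
      ((Nat.card H₁ * Nat.card H₂ * Nat.card H₃ : ℕ) : ℝ) ^ ((2 + ε) / 3) := by
  intro hlt
  have h := crux_law hε htpp hdes hlt
  rw [ncard_irr_levelOne hl] at h
  exact absurd (h.trans_le hthr) (lt_irrefl _)

end LevelOneClassification
end Summit.MatrixMultiplication.MatrixMultiplication.Theorems.SubgroupIdentityDesigns.Negative
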